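import Summits.AtomisticToContinuum.BoseEinsteinCondensation.Theses.BECConjugateDomination

/-!
# Triage r2-1 certificate for card `budget-sign-residue` (crux stmt-AtomisticToContinuum-11784)

Self-contained: the objects and the three Props `BudgetIdentity`, `DemotionSign K₀`,
`PromotionResidueFloor K₀` (and `Frame`, `OccupationConjugateLawWindow`) below are VERBATIM copies of
the ideator's `Cruxes/InfraredMinimumUncertainty/IdeatorSketch_r2_k5.lean` (namespace `…Sketch5`), which is
a crux workfile and not a built module on the farm (import reported `unbuilt`), hence re-declared here under
the namespace `…TriageR2K1`.

**Finding F1 (costume by normalisation).**  The three typed Props imply, by the SAME order arithmetic as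
the card's own glue `occupationConjugateLaw_of_budget_sign_floor`, a CONDENSATE-FRACTION FLOOR at every
window mode:

  `N · √((n_m + 1) · S_m) ≤ C · n₀`,  i.e.  `f = n₀/N ≥ √((n_m+1) S_m) / C ≥ √(S_m) / C`

(`t₊ = n₀ − n_m + t₋ ≤ n₀` from the budget and the sign; then the floor `N√q ≤ C t₊ ≤ C n₀`) —
`condensateFloor_of_budget_sign_floor`.  So the floor stub `T₊` as typed (normalised by `N`, not by `n₀`)
is condensation in costume: with ANY `O(1)` floor on `S_m` at ONE healing-scale mode `‖k‖ ≈ K₀√ρ` (e.g. the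
route's PuffFloor: `S ≥ K₀/√(K₀² + C_P)` there), `T₊ ∧ Σ₋ ∧ Budget` give `f ≥ c > 0` for the positive
minimiser directly — no conjugate law, no Lévy bridge, no UV tail and no infrared mode is used.  In the
Tonks limit (d = 1 hard core; outside the frame, but the card's declared consistency check) `f ≍ N^{-1/2}`
and `(n_{k₁}+1)S_{k₁} ≍ N^{-1/2}`, so `T₊` FAILS for large `N` although IMU (`Π → 1/4`) and `Σ₋` (card census,
403/403 modes) hold.

**Repair.**  The `n₀`-normalised floor `T₊' : n₀·√((n_m+1)S_m) ≤ C·t₊` (`= r₊/f ≥ 1/C`, the census column;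
Bogoliubov `C = 1`) composes identically — `occupationConjugateLaw_of_budget_sign_condFloor`.
-/

noncomputable section

open MeasureTheory Filter Set
open scoped ENNReal NNReal BigOperators ComplexConjugate

namespace Summit.AtomisticToContinuum.BoseEinsteinCondensation.Cruxes.InfraredMinimumUncertainty.TriageR2K1

open Literature.MathematicalPhysics.QuantumManyBody.BoseGas

/-! ## Verbatim copies of the ideator's objects and Props (IdeatorSketch_r2_k5.lean, namespace `Sketch5`) -/

/-- Wave vector `k = 2π m / L`. -/
def waveVec (L : ℝ) (m : Fin 3 → ℤ) : Space :=
  (2 * Real.pi / L) • latticeVec 1 m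

/-- `n_m / N`. -/
def occFrac (n : ℕ) (L : ℝ) (ψ : Config (n + 1) → ℂ) (m : Fin 3 → ℤ) : ℝ :=
  ∫ Y in cellN n L, ‖∫ x in cell L, starRingEnd ℂ (cellWave L m x) * ψ (Matrix.vecCons x Y)‖ ^ 2 / L ^ 3

/-- `n₀ / N = f`. -/
def condFrac (n : ℕ) (L : ℝ) (ψ : Config (n + 1) → ℂ) : ℝ :=
  ∫ Y in cellN n L, ‖∫ x in cell L, ψ (Matrix.vecCons x Y)‖ ^ 2 / L ^ 3

/-- `S_m` (verbatim the crux's `let S`). -/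
def structureFactor (n : ℕ) (L : ℝ) (ψ : Config (n + 1) → ℂ) (m : Fin 3 → ℤ) : ℝ :=
  ((n : ℝ) + 1)⁻¹ * ∫ X in cellN (n + 1) L, ‖∑ j : Fin (n + 1), cellWave L m (X j)‖ ^ 2 * ‖ψ X‖ ^ 2

/-- `conj(ρ_m)(x, Y)`. -/
def densityBar (n : ℕ) (L : ℝ) (m : Fin 3 → ℤ) (x : Space) (Y : Config n) : ℂ :=
  starRingEnd ℂ (cellWave L m x) + ∑ l : Fin n, starRingEnd ℂ (cellWave L m (Y l))

/-- `t₋ = Re⟨a₀†a_m Ψ, ρ̄_m Ψ⟩`. -/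
def demotionOverlap (n : ℕ) (L : ℝ) (ψ : Config (n + 1) → ℂ) (m : Fin 3 → ℤ) : ℝ :=
  ((n : ℝ) + 1) / L ^ 3 *
    (∫ x in cell L, ∫ Y in cellN n L,
      (∫ y in cell L, cellWave L m y * starRingEnd ℂ (ψ (Matrix.vecCons y Y))) *
        densityBar n L m x Y * ψ (Matrix.vecCons x Y)).re

/-- `t₊ = Re⟨a†_{−m}a₀ Ψ, ρ̄_m Ψ⟩`. -/
def promotionOverlap (n : ℕ) (L : ℝ) (ψ : Config (n + 1) → ℂ) (m : Fin 3 → ℤ) : ℝ :=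
  ((n : ℝ) + 1) / L ^ 3 *
    (∫ x in cell L, ∫ Y in cellN n L,
      (∫ y in cell L, starRingEnd ℂ (ψ (Matrix.vecCons y Y))) *
        (cellWave L m x * densityBar n L m x Y * ψ (Matrix.vecCons x Y))).re

/-- Budget identity `t₊ − t₋ = n₀ − n_m` with `0 ≤ n_m/N`, `n₀/N ≤ 1` (verbatim). -/
def BudgetIdentity : Prop :=
  ∀ (n : ℕ) (L : ℝ), 0 < L → ∀ Ψ : PeriodicTrialState (n + 1) L, (∀ X, Ψ.ψ X = (‖Ψ.ψ X‖ : ℂ)) →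
    ∀ m : Fin 3 → ℤ,
      promotionOverlap n L Ψ.ψ m - demotionOverlap n L Ψ.ψ m =
          ((n : ℝ) + 1) * condFrac n L Ψ.ψ - ((n : ℝ) + 1) * occFrac n L Ψ.ψ m ∧
      0 ≤ occFrac n L Ψ.ψ m ∧ condFrac n L Ψ.ψ ≤ 1

/-- The crux frame (verbatim). -/
def Frame (P : (ℝ → ℝ≥0∞) → ℝ → ∀ (ρ : ℝ) (n : ℕ),
    PeriodicTrialState (n + 1) (sideLength ρ (n + 1)) → Prop) : Prop :=
  ∀ v : ℝ → ℝ≥0∞, IsRepulsiveFiniteRange v → (∀ r, v r ≠ ⊤) →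
    ContDiff ℝ 2 (fun x : Space => (v ‖x‖).toReal) →
    (∃ Cₑ : ℝ, ∀ x : Space,
      ‖iteratedFDeriv ℝ 2 (fun x : Space => (v ‖x‖).toReal) x‖ ≤ Cₑ * Real.sqrt ((v ‖x‖).toReal)) →
    ∃ C : ℝ, 0 ≤ C ∧ ∃ ρ₀ : ℝ, 0 < ρ₀ ∧ ∀ ρ : ℝ, 0 < ρ → ρ < ρ₀ → ∀ᶠ n : ℕ in atTop,
      ∀ Ψ : PeriodicTrialState (n + 1) (sideLength ρ (n + 1)),
        periodicEnergy v Ψ = periodicGroundStateEnergy v (n + 1) (sideLength ρ (n + 1)) →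
        periodicEnergy v Ψ ≠ ⊤ → (∀ X, Ψ.ψ X = (‖Ψ.ψ X‖ : ℂ)) → (∀ X, Ψ.ψ X ≠ 0) → P v C ρ n Ψ

/-- Stub Σ₋ (verbatim). -/
def DemotionSign (K₀ : ℝ) : Prop :=
  Frame fun _v _C ρ n Ψ => ∀ m : Fin 3 → ℤ, m ≠ 0 →
    ‖waveVec (sideLength ρ (n + 1)) m‖ ≤ K₀ * Real.sqrt ρ →
      demotionOverlap n (sideLength ρ (n + 1)) Ψ.ψ m ≤ 0

/-- Stub T₊ (verbatim; NOTE the normalisation by `N = n+1` on the left). -/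
def PromotionResidueFloor (K₀ : ℝ) : Prop :=
  Frame fun _v C ρ n Ψ => ∀ m : Fin 3 → ℤ, m ≠ 0 →
    ‖waveVec (sideLength ρ (n + 1)) m‖ ≤ K₀ * Real.sqrt ρ →
      ((n : ℝ) + 1) * Real.sqrt ((((n : ℝ) + 1) * occFrac n (sideLength ρ (n + 1)) Ψ.ψ m + 1) *
          structureFactor n (sideLength ρ (n + 1)) Ψ.ψ m) ≤
        C * promotionOverlap n (sideLength ρ (n + 1)) Ψ.ψ m

/-- Output on the window (verbatim). -/
def OccupationConjugateLawWindow (K₀ : ℝ) : Prop :=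
  Frame fun _v C ρ n Ψ => ∀ m : Fin 3 → ℤ, m ≠ 0 →
    ‖waveVec (sideLength ρ (n + 1)) m‖ ≤ K₀ * Real.sqrt ρ →
      (((n : ℝ) + 1) * occFrac n (sideLength ρ (n + 1)) Ψ.ψ m + 1) *
          structureFactor n (sideLength ρ (n + 1)) Ψ.ψ m ≤ C

/-! ## F1: the typed cut carries a condensate-fraction floor -/

/-- The condensate-fraction floor hidden in the typed cut: on the window,
`N · √((n_m+1)·S_m) ≤ C · n₀` (with `n₀ = N · condFrac`), i.e. `f ≥ √((n_m+1)S_m)/C`. -/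
def CondensateFloorWindow (K₀ : ℝ) : Prop :=
  Frame fun _v C ρ n Ψ => ∀ m : Fin 3 → ℤ, m ≠ 0 →
    ‖waveVec (sideLength ρ (n + 1)) m‖ ≤ K₀ * Real.sqrt ρ →
      ((n : ℝ) + 1) * Real.sqrt ((((n : ℝ) + 1) * occFrac n (sideLength ρ (n + 1)) Ψ.ψ m + 1) *
          structureFactor n (sideLength ρ (n + 1)) Ψ.ψ m) ≤
        C * (((n : ℝ) + 1) * condFrac n (sideLength ρ (n + 1)) Ψ.ψ)

/-- **Budget + sign + (N-normalised) floor ⇒ a condensate-fraction floor at every window mode.**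
Kernel certificate that `PromotionResidueFloor` as typed asserts `f ≥ √((n_m+1)S_m)/C` (given Σ₋). -/
theorem condensateFloor_of_budget_sign_floor (K₀ : ℝ) (hB : BudgetIdentity)
    (hS : DemotionSign K₀) (hT : PromotionResidueFloor K₀) : CondensateFloorWindow K₀ := by
  intro v hv hfin hC2 hedge
  obtain ⟨C₁, _hC₁, ρ₁, hρ₁, h₁⟩ := hS v hv hfin hC2 hedge
  obtain ⟨C₂, hC₂, ρ₂, hρ₂, h₂⟩ := hT v hv hfin hC2 hedge
  refine ⟨C₂, hC₂, min ρ₁ ρ₂, lt_min hρ₁ hρ₂, ?_⟩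
  intro ρ hρ hρlt
  have hρ1 : ρ < ρ₁ := lt_of_lt_of_le hρlt (min_le_left _ _)
  have hρ2 : ρ < ρ₂ := lt_of_lt_of_le hρlt (min_le_right _ _)
  filter_upwards [h₁ ρ hρ hρ1, h₂ ρ hρ hρ2] with n hn₁ hn₂
  intro Ψ hE hEfin hreal hpos m hm hwin
  have hsign := hn₁ Ψ hE hEfin hreal hpos m hm hwin
  have hfloor := hn₂ Ψ hE hEfin hreal hpos m hm hwin
  have hL : 0 < sideLength ρ (n + 1) := by
    unfold sideLength
    apply Real.rpow_pos_of_pos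
    positivity
  obtain ⟨hbud, hocc, _hcond⟩ := hB n (sideLength ρ (n + 1)) hL Ψ hreal m
  have hN : (0 : ℝ) < (n : ℝ) + 1 := by positivity
  -- t₊ = n₀ - n_m + t₋ ≤ n₀
  have htp : promotionOverlap n (sideLength ρ (n + 1)) Ψ.ψ m ≤
      ((n : ℝ) + 1) * condFrac n (sideLength ρ (n + 1)) Ψ.ψ := by
    have hnm : 0 ≤ ((n : ℝ) + 1) * occFrac n (sideLength ρ (n + 1)) Ψ.ψ m := mul_nonneg hN.le hocc
    linarith
  calc ((n : ℝ) + 1) * Real.sqrt ((((n : ℝ) + 1) * occFrac n (sideLength ρ (n + 1)) Ψ.ψ m + 1) *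
          structureFactor n (sideLength ρ (n + 1)) Ψ.ψ m)
        ≤ C₂ * promotionOverlap n (sideLength ρ (n + 1)) Ψ.ψ m := hfloor
    _ ≤ C₂ * (((n : ℝ) + 1) * condFrac n (sideLength ρ (n + 1)) Ψ.ψ) :=
          mul_le_mul_of_nonneg_left htp hC₂

/-! ## Repair: the `n₀`-normalised floor composes identically -/

/-- The `n₀`-normalised (f-free) floor: `n₀ · √((n_m+1)·S_m) ≤ C · t₊` on the window
(`r₊' := t₊/(n₀√((n_m+1)S_m)) ≥ 1/C`; Bogoliubov `r₊' = 1`; the card's census column `r₊/f`). -/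
def PromotionResidueFloorCond (K₀ : ℝ) : Prop :=
  Frame fun _v C ρ n Ψ => ∀ m : Fin 3 → ℤ, m ≠ 0 →
    ‖waveVec (sideLength ρ (n + 1)) m‖ ≤ K₀ * Real.sqrt ρ →
      (((n : ℝ) + 1) * condFrac n (sideLength ρ (n + 1)) Ψ.ψ) *
          Real.sqrt ((((n : ℝ) + 1) * occFrac n (sideLength ρ (n + 1)) Ψ.ψ m + 1) *
            structureFactor n (sideLength ρ (n + 1)) Ψ.ψ m) ≤
        C * promotionOverlap n (sideLength ρ (n + 1)) Ψ.ψ m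

/-- **The repaired cut composes identically**: budget + sign + `n₀`-normalised floor ⇒ the occupation
conjugate law on the window, given `n₀ > 0` (automatic for a pointwise-positive `Ψ`; taken here as the
hypothesis `0 < condFrac` to keep the certificate measure-theory-free). -/
theorem occupationConjugateLaw_of_budget_sign_condFloor (K₀ : ℝ) (hB : BudgetIdentity)
    (hpos : ∀ (n : ℕ) (L : ℝ), 0 < L → ∀ Ψ : PeriodicTrialState (n + 1) L,
      (∀ X, Ψ.ψ X = (‖Ψ.ψ X‖ : ℂ)) → (∀ X, Ψ.ψ X ≠ 0) → 0 < condFrac n L Ψ.ψ)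
    (hS : DemotionSign K₀) (hT : PromotionResidueFloorCond K₀) : OccupationConjugateLawWindow K₀ := by
  intro v hv hfin hC2 hedge
  obtain ⟨C₁, _hC₁, ρ₁, hρ₁, h₁⟩ := hS v hv hfin hC2 hedge
  obtain ⟨C₂, hC₂, ρ₂, hρ₂, h₂⟩ := hT v hv hfin hC2 hedge
  refine ⟨C₂ ^ 2, by positivity, min ρ₁ ρ₂, lt_min hρ₁ hρ₂, ?_⟩
  intro ρ hρ hρlt
  have hρ1 : ρ < ρ₁ := lt_of_lt_of_le hρlt (min_le_left _ _)
  have hρ2 : ρ < ρ₂ := lt_of_lt_of_le hρlt (min_le_right _ _)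
  filter_upwards [h₁ ρ hρ hρ1, h₂ ρ hρ hρ2] with n hn₁ hn₂
  intro Ψ hE hEfin hreal hpos' m hm hwin
  have hsign := hn₁ Ψ hE hEfin hreal hpos' m hm hwin
  have hfloor := hn₂ Ψ hE hEfin hreal hpos' m hm hwin
  have hL : 0 < sideLength ρ (n + 1) := by
    unfold sideLength
    apply Real.rpow_pos_of_pos
    positivity
  obtain ⟨hbud, hocc, _hcond⟩ := hB n (sideLength ρ (n + 1)) hL Ψ hreal m
  have hN : (0 : ℝ) < (n : ℝ) + 1 := by positivity
  have hf : 0 < ((n : ℝ) + 1) * condFrac n (sideLength ρ (n + 1)) Ψ.ψ :=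
    mul_pos hN (hpos n _ hL Ψ hreal hpos')
  have hSnn : 0 ≤ structureFactor n (sideLength ρ (n + 1)) Ψ.ψ m := by
    unfold structureFactor
    exact mul_nonneg (inv_nonneg.mpr hN.le) (integral_nonneg fun X => by positivity)
  have hnm : 0 ≤ ((n : ℝ) + 1) * occFrac n (sideLength ρ (n + 1)) Ψ.ψ m := mul_nonneg hN.le hocc
  have hq : 0 ≤ (((n : ℝ) + 1) * occFrac n (sideLength ρ (n + 1)) Ψ.ψ m + 1) *
      structureFactor n (sideLength ρ (n + 1)) Ψ.ψ m := mul_nonneg (by linarith) hSnn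
  -- t₊ ≤ n₀ (budget + sign); then n₀ √q ≤ C t₊ ≤ C n₀; divide by n₀ > 0
  have htp : promotionOverlap n (sideLength ρ (n + 1)) Ψ.ψ m ≤
      ((n : ℝ) + 1) * condFrac n (sideLength ρ (n + 1)) Ψ.ψ := by linarith
  have h1 : ((n : ℝ) + 1) * condFrac n (sideLength ρ (n + 1)) Ψ.ψ *
      Real.sqrt ((((n : ℝ) + 1) * occFrac n (sideLength ρ (n + 1)) Ψ.ψ m + 1) *
        structureFactor n (sideLength ρ (n + 1)) Ψ.ψ m) ≤
      ((n : ℝ) + 1) * condFrac n (sideLength ρ (n + 1)) Ψ.ψ * C₂ := by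
    calc _ ≤ C₂ * promotionOverlap n (sideLength ρ (n + 1)) Ψ.ψ m := hfloor
      _ ≤ C₂ * (((n : ℝ) + 1) * condFrac n (sideLength ρ (n + 1)) Ψ.ψ) :=
            mul_le_mul_of_nonneg_left htp hC₂
      _ = ((n : ℝ) + 1) * condFrac n (sideLength ρ (n + 1)) Ψ.ψ * C₂ := by ring
  have hr : Real.sqrt ((((n : ℝ) + 1) * occFrac n (sideLength ρ (n + 1)) Ψ.ψ m + 1) *
        structureFactor n (sideLength ρ (n + 1)) Ψ.ψ m) ≤ C₂ := le_of_mul_le_mul_left h1 hf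
  calc (((n : ℝ) + 1) * occFrac n (sideLength ρ (n + 1)) Ψ.ψ m + 1) *
          structureFactor n (sideLength ρ (n + 1)) Ψ.ψ m
        = Real.sqrt ((((n : ℝ) + 1) * occFrac n (sideLength ρ (n + 1)) Ψ.ψ m + 1) *
            structureFactor n (sideLength ρ (n + 1)) Ψ.ψ m) ^ 2 := (Real.sq_sqrt hq).symm
    _ ≤ C₂ ^ 2 := by
          have h0 := Real.sqrt_nonneg ((((n : ℝ) + 1) * occFrac n (sideLength ρ (n + 1)) Ψ.ψ m + 1) *
            structureFactor n (sideLength ρ (n + 1)) Ψ.ψ m)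
          nlinarith

end Summit.AtomisticToContinuum.BoseEinsteinCondensation.Cruxes.InfraredMinimumUncertainty.TriageR2K1

end
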